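import Literature.AlgebraicGeometry.Resolution.ReducedCurveGermNormalization
import Mathlib.RingTheory.DedekindDomain.Basic
import Mathlib.RingTheory.RegularLocalRing.Defs
import HarnessLib

/-!
# The normalization colength `length_R(R̄/R)`: base change along isomorphisms, and `R̄ = R`

Topic: `Literature/AlgebraicGeometry/Resolution`. Bookkeeping for Kollár 2007, Thm. 1.101
(3) ⇒ (1) in the reduced case: the invariant `δ(R) = length_R(R̄/R)`, `R̄` the integral closure of
`R` in a total ring of fractions `L`, is insensitive to replacing `R` by an isomorphic ring acting
on the same `L`, and to replacing `L` by another total ring of fractions; and `δ(R) = 0`, i.e.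
`R̄ = R`, forces a reduced one-dimensional Noetherian local ring to be regular (Kollár,
Lemma 1.99 / Thm. 1.101 (2) ⇒ (1), last step: a normal one-dimensional local ring is a discrete
valuation ring). PROVED here:

* `mem_integralClosure_iff_of_ringEquiv`, `module_finite_integralClosure_of_ringEquiv_of_eq`,
  `length_normalizationQuotient_eq_of_ringEquiv` — for `e : T ≃+* T₂` compatible with the
  structure maps to `L`, the integral closures of `T` and `T₂` in `L` agree, finiteness transfers,
  and `length_T(T̄/T) = length_{T₂}(T̄₂/T₂)`;
* `module_finite_integralClosure_of_isFractionRing_total`, `length_normalizationQuotient_eq_of_isFractionRing`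
  — independence of the chosen total ring of fractions;
* `isRegularLocalRing_of_integralClosure_le` — **if `R̄ = R` then `R` is regular**: the
  idempotents of the Artinian reduced ring `L` lie in `R̄ = R`, so `L` is a field, `R` is an
  integrally closed Noetherian local domain of dimension one, hence Dedekind, hence regular.

No definitions, no named facts. Source: J. Kollár, *Lectures on Resolution of Singularities*
(2007), §1.13, Lemma 1.99, Thm. 1.101 [Kollar2007].
-/

noncomputable section

open IsLocalRing Polynomial nonZeroDivisors

namespace Literature.AlgebraicGeometry.Resolution

universe u

/-! ## Base change along a ring isomorphism acting on the same ambient ring -/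

section RingEquiv

variable {T T₂ L : Type u} [CommRing T] [CommRing T₂] [CommRing L] [Algebra T L] [Algebra T₂ L]
  (e : T ≃+* T₂) (he : ∀ x, algebraMap T L x = algebraMap T₂ L (e x))

include he in
/-- Integrality over `T` and over `T₂ ≅ T` (compatibly with the maps to `L`) agree.
[cite: Kollar2007, Thm. 1.101] -/
theorem mem_integralClosure_iff_of_ringEquiv (x : L) :
    x ∈ integralClosure T L ↔ x ∈ integralClosure T₂ L := by
  have hcomp : (algebraMap T₂ L).comp e.toRingHom = algebraMap T L := RingHom.ext fun x => (he x).symm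
  have hcomp' : (algebraMap T L).comp e.symm.toRingHom = algebraMap T₂ L := RingHom.ext fun x => by
    rw [RingHom.comp_apply, RingEquiv.toRingHom_eq_coe, RingEquiv.coe_toRingHom, he,
      RingEquiv.apply_symm_apply]
  constructor
  · rintro ⟨p, hp, hpx⟩
    refine ⟨p.map e.toRingHom, hp.map _, ?_⟩
    rw [eval₂_map, hcomp]; exact hpx
  · rintro ⟨p, hp, hpx⟩
    refine ⟨p.map e.symm.toRingHom, hp.map _, ?_⟩
    rw [eval₂_map, hcomp']; exact hpx

include he in
/-- Finiteness of the normalization transfers along `e : T ≃+* T₂`. [cite: Kollar2007, Thm. 1.101] -/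
theorem module_finite_integralClosure_of_ringEquiv_of_eq [Module.Finite T (integralClosure T L)] :
    Module.Finite T₂ (integralClosure T₂ L) := by
  classical
  obtain ⟨S, hS⟩ := Module.Finite.fg_top (R := T) (M := integralClosure T L)
  refine ⟨⟨S.image fun s : integralClosure T L =>
    (⟨(s : L), (mem_integralClosure_iff_of_ringEquiv e he _).mp s.2⟩ : integralClosure T₂ L), ?_⟩⟩
  rw [eq_top_iff]
  rintro ⟨x, hx⟩ -
  have hx' : (⟨x, (mem_integralClosure_iff_of_ringEquiv e he x).mpr hx⟩ : integralClosure T L) ∈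
      Submodule.span T (S : Set (integralClosure T L)) := by rw [hS]; trivial
  -- follow a `T`-linear combination
  suffices h : ∀ w : integralClosure T L, w ∈ Submodule.span T (S : Set (integralClosure T L)) →
      (⟨(w : L), (mem_integralClosure_iff_of_ringEquiv e he _).mp w.2⟩ : integralClosure T₂ L) ∈
        Submodule.span T₂ ((S.image fun s : integralClosure T L => (⟨(s : L),
          (mem_integralClosure_iff_of_ringEquiv e he _).mp s.2⟩ : integralClosure T₂ L)) :
          Set (integralClosure T₂ L)) from h _ hx'
  intro w hw
  induction hw using Submodule.span_induction with
  | mem w hw =>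
    refine Submodule.subset_span ?_
    rw [Finset.coe_image]
    exact ⟨w, hw, rfl⟩
  | zero => exact Submodule.zero_mem _
  | add w₁ w₂ _ _ h₁ h₂ =>
    have : (⟨((w₁ + w₂ : integralClosure T L) : L), (mem_integralClosure_iff_of_ringEquiv e he _).mp
        (w₁ + w₂).2⟩ : integralClosure T₂ L) =
        ⟨(w₁ : L), (mem_integralClosure_iff_of_ringEquiv e he _).mp w₁.2⟩ +
        ⟨(w₂ : L), (mem_integralClosure_iff_of_ringEquiv e he _).mp w₂.2⟩ := Subtype.ext rfl
    rw [this]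
    exact Submodule.add_mem _ h₁ h₂
  | smul t w _ hw =>
    have : (⟨((t • w : integralClosure T L) : L), (mem_integralClosure_iff_of_ringEquiv e he _).mp
        (t • w).2⟩ : integralClosure T₂ L) =
        e t • ⟨(w : L), (mem_integralClosure_iff_of_ringEquiv e he _).mp w.2⟩ := by
      apply Subtype.ext
      change ((t • w : integralClosure T L) : L) = e t • (w : L)
      rw [Subalgebra.coe_smul, Algebra.smul_def, Algebra.smul_def, he]
    rw [this]
    exact Submodule.smul_mem _ _ hw

include he in
/-- **`length_T(T̄/T) = length_{T₂}(T̄₂/T₂)`** for `e : T ≃+* T₂` acting compatibly on the same `L`: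
the `T₂`-module `T̄₂/T₂`, viewed as a `T`-module through `e`, is `T`-isomorphic to `T̄/T`, and
lengths over `T` and `T₂` agree along the surjection `e`. [cite: Kollar2007, Thm. 1.101] -/
theorem length_normalizationQuotient_eq_of_ringEquiv :
    Module.length T (↥(integralClosure T L) ⧸
        LinearMap.range (Algebra.linearMap T ↥(integralClosure T L))) =
      Module.length T₂ (↥(integralClosure T₂ L) ⧸
        LinearMap.range (Algebra.linearMap T₂ ↥(integralClosure T₂ L))) := by
  classical
  set N := integralClosure T L with hN
  set N₂ := integralClosure T₂ L with hN₂
  set P : Submodule T N := LinearMap.range (Algebra.linearMap T N) with hP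
  set P₂ : Submodule T₂ N₂ := LinearMap.range (Algebra.linearMap T₂ N₂) with hP₂
  -- `T` acts on `T₂`-modules through `e`
  letI : Algebra T T₂ := e.toRingHom.toAlgebra
  have halg : ∀ t : T, algebraMap T T₂ t = e t := fun t => rfl
  letI modT : Module T N₂ := Module.compHom N₂ e.toRingHom
  have hsmul : ∀ (t : T) (y : N₂), t • y = e t • y := fun t y => rfl
  haveI : IsScalarTower T T₂ N₂ :=
    ⟨fun t t₂ y => by
      change (e t * t₂) • y = e t • (t₂ • y)
      rw [mul_smul]⟩
  -- the `T`-linear isomorphism `N ≃ N₂`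
  let f : N ≃ₗ[T] N₂ :=
    { toFun := fun x => ⟨(x : L), (mem_integralClosure_iff_of_ringEquiv e he _).mp x.2⟩
      invFun := fun y => ⟨(y : L), (mem_integralClosure_iff_of_ringEquiv e he _).mpr y.2⟩
      map_add' := fun x y => Subtype.ext rfl
      map_smul' := fun t x => by
        apply Subtype.ext
        change ((t • x : N) : L) = ((e t • (⟨(x : L), _⟩ : N₂) : N₂) : L)
        rw [Subalgebra.coe_smul, Subalgebra.coe_smul, Algebra.smul_def, Algebra.smul_def, he]
      left_inv := fun x => Subtype.ext rfl
      right_inv := fun y => Subtype.ext rfl }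
  have hf : ∀ x : N, ((f x : N₂) : L) = (x : L) := fun x => rfl
  -- `P` corresponds to `P₂`
  have hPmap : P.map (f : N →ₗ[T] N₂) = P₂.restrictScalars T := by
    apply le_antisymm
    · rintro _ ⟨x, ⟨t, rfl⟩, rfl⟩
      refine ⟨e t, Subtype.ext ?_⟩
      change algebraMap T₂ L (e t) = ((f (algebraMap T N t) : N₂) : L)
      rw [hf, ← he]; rfl
    · rintro y ⟨t₂, rfl⟩
      refine ⟨algebraMap T N (e.symm t₂), ⟨e.symm t₂, rfl⟩, Subtype.ext ?_⟩
      change ((f (algebraMap T N (e.symm t₂)) : N₂) : L) = algebraMap T₂ L t₂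
      rw [hf]
      change algebraMap T L (e.symm t₂) = _
      rw [he, RingEquiv.apply_symm_apply]
  have e1 : (N ⧸ P) ≃ₗ[T] (N₂ ⧸ P₂.restrictScalars T) := Submodule.Quotient.equiv P _ f hPmap
  have e2 : (N₂ ⧸ P₂.restrictScalars T) ≃ₗ[T] (N₂ ⧸ P₂) := Submodule.Quotient.restrictScalarsEquiv T P₂
  rw [(e1.trans e2).length_eq]
  exact Module.length_eq_of_surjective (S := T) (R := T₂) (M := N₂ ⧸ P₂) e.surjective

end RingEquiv

/-! ## Independence of the total ring of fractions -/

section ChangeFractionRing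

variable (T : Type u) [CommRing T] (L₁ L₂ : Type u) [CommRing L₁] [CommRing L₂] [Algebra T L₁]
  [Algebra T L₂] [IsFractionRing T L₁] [IsFractionRing T L₂]

/-- Finiteness of the normalization does not depend on the chosen total ring of fractions.
[cite: Kollar2007, Thm. 1.101] -/
theorem module_finite_integralClosure_of_isFractionRing_total
    [Module.Finite T (integralClosure T L₁)] : Module.Finite T (integralClosure T L₂) :=
  Module.Finite.equiv
    ((IsLocalization.algEquiv T⁰ L₁ L₂).mapIntegralClosure).toLinearEquiv

/-- `length_T(T̄/T)` does not depend on the chosen total ring of fractions.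
[cite: Kollar2007, Thm. 1.101] -/
theorem length_normalizationQuotient_eq_of_isFractionRing :
    Module.length T (↥(integralClosure T L₁) ⧸
        LinearMap.range (Algebra.linearMap T ↥(integralClosure T L₁))) =
      Module.length T (↥(integralClosure T L₂) ⧸
        LinearMap.range (Algebra.linearMap T ↥(integralClosure T L₂))) := by
  let g : integralClosure T L₁ ≃ₐ[T] integralClosure T L₂ :=
    (IsLocalization.algEquiv T⁰ L₁ L₂).mapIntegralClosure
  have hmap : (LinearMap.range (Algebra.linearMap T ↥(integralClosure T L₁))).map
      g.toLinearEquiv.toLinearMap =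
      LinearMap.range (Algebra.linearMap T ↥(integralClosure T L₂)) := by
    apply le_antisymm
    · rintro _ ⟨w, ⟨r, rfl⟩, rfl⟩
      exact ⟨r, (g.commutes r).symm⟩
    · rintro w ⟨r, rfl⟩
      exact ⟨algebraMap T _ r, ⟨r, rfl⟩, g.commutes r⟩
  exact (Submodule.Quotient.equiv _ _ g.toLinearEquiv hmap).length_eq

end ChangeFractionRing

/-! ## `R̄ = R` forces regularity -/

section Regular

/-- **If `R̄ = R` then `R` is regular** (Kollár Thm. 1.101, (2) ⇒ (1), the terminal case; Lemma
1.99): for a reduced Noetherian local ring `R` of dimension one whose integral closure in its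
total ring of fractions `L` equals `R`, the idempotents of the Artinian reduced ring `L` are
integral, hence lie in the local ring `R`, hence are trivial; so `L` is a field, `R` is an
integrally closed Noetherian local domain of dimension one, i.e. a Dedekind domain, and such rings
are regular. [cite: Kollar2007, Thm. 1.101] -/
theorem isRegularLocalRing_of_integralClosure_le (R : Type u) [CommRing R] [IsLocalRing R]
    [IsNoetherianRing R] [IsReduced R] (L : Type u) [CommRing L] [Algebra R L] [IsFractionRing R L]
    (hdim : ringKrullDim R = 1)
    (h : ∀ x ∈ integralClosure R L, x ∈ Set.range (algebraMap R L)) : IsRegularLocalRing R := by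
  classical
  haveI : IsArtinianRing L := isArtinianRing_of_isFractionRing_of_isReduced (R := R) L
  haveI : IsReduced L := isReduced_of_isFractionRing R L
  have hinj : Function.Injective (algebraMap R L) := IsFractionRing.injective R L
  -- every idempotent of `L` is `0` or `1`
  have hidem : ∀ f : L, f * f = f → f = 0 ∨ f = 1 := by
    intro f hf
    have hint : f ∈ integralClosure R L := by
      refine ⟨X ^ 2 - X, (monic_X_pow 2).sub_of_left (by rw [degree_X_pow, degree_X]; decide), ?_⟩
      rw [eval₂_sub, eval₂_X_pow, eval₂_X, pow_two, hf, sub_self]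
    obtain ⟨r, hr⟩ := h f hint
    have hr2 : r * r = r := hinj (by rw [map_mul, hr, hf])
    -- an idempotent of a local ring is `0` or `1`
    rcases IsLocalRing.isUnit_or_isUnit_one_sub_self r with hu | hu
    · right
      obtain ⟨ri, hri⟩ := hu.exists_left_inv
      have : r = 1 := by
        calc r = ri * r * r := by rw [hri, one_mul]
          _ = ri * r := by rw [mul_assoc, hr2]
          _ = 1 := hri
      rw [← hr, this, map_one]
    · left
      obtain ⟨ri, hri⟩ := hu.exists_left_inv
      have h2 : (1 - r) * r = 0 := by rw [sub_mul, one_mul, hr2, sub_self]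
      have : r = 0 := by
        calc r = ri * (1 - r) * r := by rw [hri, one_mul]
          _ = 0 := by rw [mul_assoc, h2, mul_zero]
      rw [← hr, this, map_zero]
  -- hence `L` has exactly one maximal ideal, and is a field
  obtain ⟨I⟩ : Nonempty (MaximalSpectrum L) := by
    haveI : Nontrivial L := hinj.nontrivial
    obtain ⟨m, hm⟩ := Ideal.exists_maximal L
    exact ⟨⟨m, hm⟩⟩
  have huniq : ∀ J : MaximalSpectrum L, J = I := by
    intro J
    by_contra hJ
    obtain ⟨f, -, hfI, hfJ⟩ := exists_idempotent_lift R L I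
    have hff : f * f = f := by
      apply eq_of_forall_quotient_mk_eq (K := L)
      intro J'
      rw [map_mul]
      by_cases hJ' : J' = I
      · subst hJ'; rw [hfI, mul_one]
      · rw [hfJ J' hJ', mul_zero]
    rcases hidem f hff with h0 | h1
    · rw [h0, map_zero] at hfI; exact zero_ne_one hfI
    · have h2 := hfJ J hJ
      rw [h1, map_one] at h2
      exact one_ne_zero h2
  have hfield : IsField L := by
    -- `L ≅ ∏_J L/J` with a single factor, a field
    letI : Unique (MaximalSpectrum L) := ⟨⟨I⟩, huniq⟩
    letI : Field (L ⧸ I.asIdeal) := Ideal.Quotient.field I.asIdeal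
    let E : L ≃+* (L ⧸ I.asIdeal) :=
      (IsArtinianRing.equivPi L).toRingEquiv.trans (RingEquiv.piUnique _)
    exact MulEquiv.isField (Field.toIsField _) E.toMulEquiv
  haveI : IsDomain L := by letI := hfield.toField; infer_instance
  haveI : IsDomain R := Function.Injective.isDomain (algebraMap R L) hinj
  haveI : IsIntegrallyClosed R := (isIntegrallyClosed_iff L).mpr fun {x} hx => by
    obtain ⟨y, hy⟩ := h x hx
    exact ⟨y, hy⟩
  haveI : Ring.KrullDimLE 1 R := Ring.krullDimLE_iff.mpr hdim.le
  haveI : Ring.DimensionLEOne R :=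
    ⟨fun hne hp => (Ring.krullDimLE_one_iff_of_noZeroDivisors.mp inferInstance) _ hne hp⟩
  haveI : IsDedekindDomain R := { }
  exact IsRegularLocalRing.of_isRegularRing_of_isLocalRing R

end Regular

end Literature.AlgebraicGeometry.Resolution

end
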